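import Summits.MatrixMultiplication.MatrixMultiplication.Theorems.AbelianSTPPCensusVPUniformBlind
import Summits.MatrixMultiplication.MatrixMultiplication.Theorems.AbelianSTPPCensusVPCeiling6144
import Summits.MatrixMultiplication.MatrixMultiplication.Theorems.AbelianSTPPCensusTAKnap575Defs

/-!
# Energy-type rules do not move the asymptotic ceiling of the shape census: vQ-class instruments are blind from `8192` (T_E) and `25392` (T_A)

Cell mm-stpp (rung F-M1).  The successor shape instrument registered 2026-08-27 is vQ := vP ∧ E3⁺ (CENSUS-PLAN §6.1 (ae)): the shape sieve
vP (`SieveAdmissibleVP` = vM ∧ U11-G ∧ U11-P) plus the three-room energy rules of seat eng-2 g4 (`STPPThreeRoomEnergy.three_room_energy`, E3,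
p490420; `three_room_energy_plus`, E3⁺, p491649; E3⁺⁺, p494269).  Every energy rule of this family constrains only members `t` with
`2·V_t > M` (hypothesis `hbig : |G| < 2·|A_t||B_t||C_t|`: below it the block set `W_t − W_t` need not be the whole group).  Call a shape rule
`R M a b c` SILENT BELOW DOUBLING if it holds for every list all of whose members have `2·V_t ≤ M`; the shape form `TAKnap575.E3Adm` of E3
is such a rule (`e3Adm_of_small`), and so is any conjunction of E3/E3⁺/E3⁺⁺-type clauses.

* **T_E (`τ = 5/2`): for every `M ≥ 8192` and every rule `R` silent below doubling, the census statement
  «`∀ N M' a b c, 2 ≤ N → M' ≤ M → SieveAdmissibleVP M' a b c → R M' a b c → ¬ Beats (5/2) M' a b c`» is FALSE**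
  (`silent_censusTE_false_above_8192`; instance `vqCensusTE_false_above_8192` for `R = E3Adm`): the witness is the uniform family
  `(16,16,16) × ⌊M/768⌋` of `vpCensusTE_false_above_6144` (`AbelianSTPPCensusVPCeiling6144.lean`, p427604), whose members have
  `2V = 8192 ≤ M`.  (At `6144 ≤ M ≤ 8191` E3⁺ does kill that particular family — `STPPThreeRoomEnergy.no_16x3_x8_at_6144` — so the energy
  rules move the THRESHOLD of this witness from `6144` to `8192`, not the phenomenon.)
* **T_A (`τ = 2.371`, the record exponent): for every `M ≥ 25392` and every rule `R` silent below doubling, the census statement with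
  `Beats (2371/1000)` is FALSE** (`silent_censusTA_false_above_25392`; instance `vqCensusTA_false_above_25392`): witness the uniform family
  `(23,23,23) × k`, `k = ⌊M/1587⌋` (`1587 = 3·23²`): vP-admissible by the landed `uniform_sieveAdmissibleVP` (packing slack `3ks² ≤ M`,
  `s³ + ks² ≤ M`), silent for `R` since `2·23³ = 24334 ≤ M`, and beating because `23^{3·2371/3000} = 12167^{2371/3000} > 1692`
  (`1692^3000 ≤ 12167^2371`, `decide` with kernel reduction) and `1692·k > M` once `k ≥ 16`, i.e. `M ≥ 16·1587 = 25392`.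
  For T_A the cubes must be large (`s^{0.371} > 3`, so `s ≥ 20`) because beating `2.371` with the packing slack `3ks² ≤ M` that blinds U11-G
  needs `s^{2.371} > 3s²`; `s = 23` gives the round threshold used here (seat arithmetic: every `M ≥ 25392` passes, `M = 25391` is the last
  failure of this particular witness).
So no rule of the energy family, added to vP, yields a census theorem «no abelian STPP host of order ≤ M beats τ» by shape sieving beyond
these orders — the METHOD ceiling of R-3/R-6 of the cell's KILL-MEMO, restated for the successor instrument.  Seat theory g10.
WHAT THIS IS NOT: no STPP family of these shapes is claimed to exist (R-5 (Q-ii), near-tight uniform regime); no bound on `ω`; nothing about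
non-abelian hosts; nothing about orders below the two thresholds.
-/

-- single-conjunct summit: the mandated namespace repeats `MatrixMultiplication`.
set_option linter.dupNamespace false
set_option autoImplicit false

namespace Summit.MatrixMultiplication.MatrixMultiplication.Theorems

namespace AbelianSTPPCensusVP

open Finset

/-- The shape form of E3 is silent below doubling: a list all of whose members have `2V_t ≤ M` satisfies `TAKnap575.E3Adm M`
vacuously. [bookkeeping] -/
theorem e3Adm_of_small {N M : ℕ} {a b c : Fin N → ℕ} (h : ∀ t, 2 * (a t * b t * c t) ≤ M) : TAKnap575.E3Adm M a b c :=
  fun t ht => absurd ht (not_lt.2 (h t))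

/-! ## T_E: blind from 8192 -/

/-- **T_E ceiling of every vQ-class instrument.**  For `M ≥ 8192` and any shape rule `R` silent below doubling, the census statement
«no list with `≥ 2` members that is vP-admissible and `R`-admissible at an order `≤ M` beats `5/2`» is false: the uniform family
`(16,16,16) × ⌊M/768⌋` passes vP (`sieveAdmissibleVP_c16`), passes `R` (all `2V = 8192 ≤ M`), and beats `5/2` (`beats_c16`). [original] -/
theorem silent_censusTE_false_above_8192
    (R : ∀ {N : ℕ}, ℕ → (Fin N → ℕ) → (Fin N → ℕ) → (Fin N → ℕ) → Prop)
    (hR : ∀ (N M : ℕ) (a b c : Fin N → ℕ), (∀ t, 2 * (a t * b t * c t) ≤ M) → R M a b c) {M : ℕ} (hM : 8192 ≤ M) :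
    ¬ (∀ (N M' : ℕ) (a b c : Fin N → ℕ), 2 ≤ N → M' ≤ M → SieveAdmissibleVP M' a b c → R M' a b c →
        ¬ Beats (5 / 2) M' a b c) := by
  intro h
  have h6144 : 6144 ≤ M := by omega
  exact h (M / 768) M (c16 _) (c16 _) (c16 _) (by omega) le_rfl (sieveAdmissibleVP_c16 h6144)
    (hR _ _ _ _ _ fun t => by simp only [c16_apply]; omega) (beats_c16 h6144)

/-- Instance `R = E3Adm`: the census under vP ∧ E3 (shape form) for `T_E` is false at every `M ≥ 8192`. [original] -/
theorem vqCensusTE_false_above_8192 {M : ℕ} (hM : 8192 ≤ M) :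
    ¬ (∀ (N M' : ℕ) (a b c : Fin N → ℕ), 2 ≤ N → M' ≤ M → SieveAdmissibleVP M' a b c → TAKnap575.E3Adm M' a b c →
        ¬ Beats (5 / 2) M' a b c) :=
  silent_censusTE_false_above_8192 (fun M a b c => TAKnap575.E3Adm M a b c) (fun _ _ _ _ _ h => e3Adm_of_small h) hM

/-! ## T_A: blind from 25392 -/

/-- `q ≤ x^{(2371/1000)/3}` from the integer-checkable `q^3000 ≤ x^2371`. [bookkeeping] -/
theorem le_rpow_2371 {x q : ℝ} (hx : 0 ≤ x) (hq : 0 ≤ q) (h : q ^ 3000 ≤ x ^ 2371) :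
    q ≤ x ^ ((2371 / 1000 : ℝ) / 3) := by
  have e1 : ((2371 / 1000 : ℝ) / 3) = ((2371 : ℕ) : ℝ) * ((1 : ℝ) / 3000) := by norm_num
  rw [e1, Real.rpow_natCast_mul hx]
  calc q = (q ^ 3000) ^ ((1 : ℝ) / 3000) := by
          rw [show ((1 : ℝ) / 3000) = ((3000 : ℕ) : ℝ)⁻¹ by norm_num]
          exact (Real.pow_rpow_inv_natCast hq (by norm_num)).symm
    _ ≤ (x ^ 2371) ^ ((1 : ℝ) / 3000) := Real.rpow_le_rpow (pow_nonneg hq 3000) h (by norm_num)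

/-- A uniform family `(s,s,s) × k` beats `τ = 2371/1000` once `k·q > M` for a certified lower bound `q ≤ (s³)^{2371/3000}`
(`q^3000 ≤ (s³)^2371`). [original] -/
theorem uniform_beats_2371 {M s k : ℕ} {q : ℝ} (hq : 0 ≤ q) (hq' : q ^ 3000 ≤ ((s * s * s : ℕ) : ℝ) ^ 2371)
    (hM : (M : ℝ) < k * q) : Beats (2371 / 1000) M (cu s k) (cu s k) (cu s k) := by
  unfold Beats
  simp only [shapeVol_cu, sum_const, card_univ, Fintype.card_fin, nsmul_eq_mul]
  have hq'' : q ≤ ((s * s * s : ℕ) : ℝ) ^ ((2371 / 1000 : ℝ) / 3) := le_rpow_2371 (by positivity) hq hq'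
  clear hq'
  have hk0 : (0 : ℝ) ≤ (k : ℝ) := by positivity
  nlinarith [hq'', hk0, hM]

/-- `1692^3000 ≤ 12167^2371` (`12167 = 23³`; so `12167^{2371/3000} ≥ 1692`, in fact `= 1692.9989…`). [bookkeeping] -/
theorem pow_1692_le : (1692 : ℕ) ^ 3000 ≤ 12167 ^ 2371 := by decide +kernel

/-- **T_A ceiling of every vQ-class instrument.**  For `M ≥ 25392` and any shape rule `R` silent below doubling, the census statement
«no list with `≥ 2` members that is vP-admissible and `R`-admissible at an order `≤ M` beats `2.371`» is false: witness
`(23,23,23) × ⌊M/1587⌋`. [original] -/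
theorem silent_censusTA_false_above_25392
    (R : ∀ {N : ℕ}, ℕ → (Fin N → ℕ) → (Fin N → ℕ) → (Fin N → ℕ) → Prop)
    (hR : ∀ (N M : ℕ) (a b c : Fin N → ℕ), (∀ t, 2 * (a t * b t * c t) ≤ M) → R M a b c) {M : ℕ} (hM : 25392 ≤ M) :
    ¬ (∀ (N M' : ℕ) (a b c : Fin N → ℕ), 2 ≤ N → M' ≤ M → SieveAdmissibleVP M' a b c → R M' a b c →
        ¬ Beats (2371 / 1000) M' a b c) := by
  intro h
  set k := M / 1587 with hk
  have hk16 : 16 ≤ k := by omega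
  have hkM : 1587 * k ≤ M := by omega
  have hMk : M < 1587 * k + 1587 := by omega
  have hV : 23 ^ 3 + k * 23 ^ 2 ≤ M := by norm_num; omega
  have hP : 3 * k * 23 ^ 2 ≤ M := by norm_num; omega
  have h24 : 2 * (23 * 23 * 23) ≤ M := le_trans (by norm_num) hM
  have h2V : ∀ t : Fin k, 2 * (cu 23 k t * cu 23 k t * cu 23 k t) ≤ M := fun _ => h24
  have hN : 2 ≤ k := by omega
  have hRk : R M (cu 23 k) (cu 23 k) (cu 23 k) := hR _ _ _ _ _ h2V
  have hadm : SieveAdmissibleVP M (cu 23 k) (cu 23 k) (cu 23 k) := uniform_sieveAdmissibleVP (by norm_num) hV hP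
  have hb : (M : ℝ) < k * (1692 : ℝ) := by
    have : M < k * 1692 := by omega
    exact_mod_cast this
  have hq : (1692 : ℝ) ^ 3000 ≤ ((23 * 23 * 23 : ℕ) : ℝ) ^ 2371 := by
    have h1 : (1692 : ℝ) ^ 3000 ≤ (12167 : ℝ) ^ 2371 := by exact_mod_cast pow_1692_le
    have e : ((23 * 23 * 23 : ℕ) : ℝ) = 12167 := by norm_num
    rw [e]
    exact h1
  have hbeats : Beats (2371 / 1000) M (cu 23 k) (cu 23 k) (cu 23 k) :=
    uniform_beats_2371 (s := 23) (q := 1692) (by norm_num) hq hb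
  exact h k M (cu 23 k) (cu 23 k) (cu 23 k) hN le_rfl hadm hRk hbeats

/-- Instance `R = E3Adm`: the census under vP ∧ E3 (shape form) for `T_A` is false at every `M ≥ 25392`. [original] -/
theorem vqCensusTA_false_above_25392 {M : ℕ} (hM : 25392 ≤ M) :
    ¬ (∀ (N M' : ℕ) (a b c : Fin N → ℕ), 2 ≤ N → M' ≤ M → SieveAdmissibleVP M' a b c → TAKnap575.E3Adm M' a b c →
        ¬ Beats (2371 / 1000) M' a b c) :=
  silent_censusTA_false_above_25392 (fun M a b c => TAKnap575.E3Adm M a b c) (fun _ _ _ _ _ h => e3Adm_of_small h) hM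

end AbelianSTPPCensusVP

end Summit.MatrixMultiplication.MatrixMultiplication.Theorems
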